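import Summits.ABC.ABC.Theses.PadicPrimesYuNinetyOddRadOne
import Summits.ABC.StewartYu.KappaDoor
import HarnessLib

set_option linter.dupNamespace false

/-!
# Route PadicPrimesYuNinetyOddRadOne (rung A1.M2⁻, `EpsShapeBoundOne`): the support item
# `FinBoundMergeOdd` (stmt-ABC-19457) and the `Assembly` (stmt-ABC-19458)

`Summits/ABC/ABC/Theorems/PadicPrimesYuNinetyOddRadOneClosers.lean` — cell `abc-stewartyu`, seat p3 (g2).
Both items are bookkeeping (planner: "provable-now"): the merge takes `K = max K₃ K₁`, `L = max L₃ L₁`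
(the κ-door input `KappaDoor.FinBoundAt p K L 1 2 1 2`, whose body the items inline verbatim, is
monotone in `K, L` since every other factor of the bound is non-negative: `finBoundAt_mono_KL`), and
every odd prime is `≡ 1` or `≡ 3 (mod 4)`; the Assembly is the route's own `closes`.
Everything is [folklore]. WHAT THIS IS NOT: the two cruxes (the odd-prime engines) are untouched.
-/

noncomputable section

open Finset Real

namespace Summit.ABC.ABC.Theorems

open Summit.ABC.StewartYu Summit.ABC.StewartYu.KappaDoor

/-- Monotonicity of the κ-door's one-prime input in the constants `K ≤ K'`, `L ≤ L'` (all other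
factors of the bound are non-negative). [folklore] -/
theorem finBoundAt_mono_KL {p : ℕ} {K K' L L' κ σ : ℝ} {τ τ₁ : ℕ} (hK : 0 ≤ K) (hKK' : K ≤ K')
    (hL : 0 ≤ L) (hLL' : L ≤ L') (hP : FinBoundAt p K L κ σ τ τ₁) : FinBoundAt p K' L' κ σ τ τ₁ := by
  intro n q e hq hinj hqp he hne
  refine (hP n q e hq hinj hqp he hne).trans ?_
  have hlogq : 0 ≤ ∏ i, Real.log (q i : ℝ) :=
    Finset.prod_nonneg fun i _ => Real.log_nonneg (by exact_mod_cast (hq i).one_lt.le)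
  have h1 : 0 ≤ Real.log (max 3 ((Finset.univ.sup fun i => (e i).natAbs : ℕ) : ℝ)) ^ τ :=
    pow_nonneg (Real.log_nonneg (le_trans (by norm_num) (le_max_left _ _))) _
  have h2 : 0 ≤ Real.log (max 3 (∏ i, ((q i : ℕ) : ℝ))) ^ τ₁ :=
    pow_nonneg (Real.log_nonneg (le_trans (by norm_num) (le_max_left _ _))) _
  have hrest : 0 ≤ (n : ℝ) ^ (κ * n) * (p : ℝ) ^ σ * (∏ i, Real.log (q i : ℝ)) *
      Real.log (max 3 ((Finset.univ.sup fun i => (e i).natAbs : ℕ) : ℝ)) ^ τ *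
      Real.log (max 3 (∏ i, ((q i : ℕ) : ℝ))) ^ τ₁ := by
    have hn : 0 ≤ (n : ℝ) ^ (κ * n) := Real.rpow_nonneg (Nat.cast_nonneg _) _
    have hp : 0 ≤ (p : ℝ) ^ σ := Real.rpow_nonneg (Nat.cast_nonneg _) _
    positivity
  have hKL : K * L ^ n ≤ K' * L' ^ n :=
    mul_le_mul hKK' (pow_le_pow_left₀ hL hLL' n) (pow_nonneg hL n) (hK.trans hKK')
  calc K * L ^ n * (n : ℝ) ^ (κ * n) * (p : ℝ) ^ σ * (∏ i, Real.log (q i : ℝ)) *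
        Real.log (max 3 ((Finset.univ.sup fun i => (e i).natAbs : ℕ) : ℝ)) ^ τ *
        Real.log (max 3 (∏ i, ((q i : ℕ) : ℝ))) ^ τ₁
      = K * L ^ n * ((n : ℝ) ^ (κ * n) * (p : ℝ) ^ σ * (∏ i, Real.log (q i : ℝ)) *
        Real.log (max 3 ((Finset.univ.sup fun i => (e i).natAbs : ℕ) : ℝ)) ^ τ *
        Real.log (max 3 (∏ i, ((q i : ℕ) : ℝ))) ^ τ₁) := by ring
    _ ≤ K' * L' ^ n * ((n : ℝ) ^ (κ * n) * (p : ℝ) ^ σ * (∏ i, Real.log (q i : ℝ)) *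
        Real.log (max 3 ((Finset.univ.sup fun i => (e i).natAbs : ℕ) : ℝ)) ^ τ *
        Real.log (max 3 (∏ i, ((q i : ℕ) : ℝ))) ^ τ₁) := mul_le_mul_of_nonneg_right hKL hrest
    _ = _ := by ring

/-- **Item stmt-ABC-19457 `FinBoundMergeOdd`**: the two residue-class inputs merge to one input at
every odd prime, with the maximum of the constants. [folklore] -/
theorem padicPrimesYuNinetyOddRadOne_finBoundMergeOdd_proof :
    Summit.ABC.ABC.Theses.PadicPrimesYuNinetyOddRadOne.FinBoundMergeOdd := by
  rintro ⟨K₃, L₃, hK₃, hL₃, h₃⟩ ⟨K₁, L₁, hK₁, hL₁, h₁⟩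
  refine ⟨max K₃ K₁, max L₃ L₁, le_max_of_le_left hK₃, le_max_of_le_left hL₃, fun p hp hp2 => ?_⟩
  have hodd : p % 4 = 1 ∨ p % 4 = 3 := by
    have h2 : ¬ 2 ∣ p := fun hd => hp2 ((hp.eq_one_or_self_of_dvd 2 hd).resolve_left (by norm_num)).symm
    omega
  rcases hodd with h | h
  · have hP : FinBoundAt p K₁ L₁ 1 2 1 2 := h₁ p hp h
    exact finBoundAt_mono_KL hK₁ (le_max_right _ _) (by linarith) (le_max_right _ _) hP
  · have hP : FinBoundAt p K₃ L₃ 1 2 1 2 := h₃ p hp h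
    exact finBoundAt_mono_KL hK₃ (le_max_left _ _) (by linarith) (le_max_left _ _) hP

/-- **Item stmt-ABC-19458 `Assembly`** of route `PadicPrimesYuNinetyOddRadOne`: the route's own
deciding theorem `closes`. [folklore] -/
theorem padicPrimesYuNinetyOddRadOne_assembly_proof :
    Summit.ABC.ABC.Theses.PadicPrimesYuNinetyOddRadOne.Assembly :=
  fun h₃ h₁ hM hO => Summit.ABC.ABC.Theses.PadicPrimesYuNinetyOddRadOne.closes h₃ h₁ hM hO

end Summit.ABC.ABC.Theorems

end
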